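import Summits.QuantumFields.BalabanUV.T4Continuum.Support.CTGaugeSlotDiffFactors

/-!
# T⁴ programme, spine node NE2 (U1a), sub-row Δ3 «NE2-WALK» (T4-DAG `T4-U1a.S-NE2-D3-WALK°`) — THE GAUGE SLOT UNDER CONJUGATION IN
# DIFFERENCE FORM, part 3 (the END of «Δ3-CT-HBD-B4-DIFF»): `‖c(gaugeSlot)·c((Δ_a^{(k)}⊗1)⁻¹)‖ ≤ kappa4CTd` with a constant that VANISHES
# with the background, and ROOT B's decay stations whose coupling condition is a genuine SMALL-FIELD threshold (reaches `t = 1`)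

NE2 formalisation swarm `b2b-balaban-t4-ne2-formalise-*`, leaf prover 06 (gen 3), supplier item «Δ3-CT-HBD-B4-DIFF» file E5c (E5a `CTGaugeSlotDiff`,
E5b `CTGaugeSlotDiffFactors`; chain A–E4).
 * §6 `B4diff`, **`opNorm_conjMat_gaugeDiff_le`**: one level, family `(R, T)` vs `(1, 1)`:
   `‖c(D_R·P_U·D_Rᴴ) − c((∂⊗1)·P_1·(∂⊗1)ᴴ)‖ ≤ B4diff = dZc·ν_U·z_U + z_1·(ν_U·dKc·ν_1)·z_U + z_1·ν_1·dZc` (`CTGaugeTerm.triple_sub` on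
   `c(Z_Uᴴ)c(N_U)c(Z_U) − c(Z_1ᴴ)c(N_1)c(Z_1)`; `z = e^{|κ|}(1+τ)K₂`, `ν = (σK − deltaKU)⁻¹`) — every summand carries `dZc` or `dKc`, hence a
   factor `α` or `τ`;
 * §7 `kappa4CTd`, **`hP4diff_gaugeSlot_of_regular`** (`‖c(gaugeSlot k)·c((Δ_a^{(k)}⊗1)⁻¹)‖ ≤ kappa4CTd`, both unit data THEOREMS: E3's
   `coercive_gramK_one`, E4's `coercive_gramK_family`) and **`balaban_final_decayStations_of_regular_smallField`** — the owner's ROOT-B decay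
   stations with `hdec` fed by the chain and the gauge slot in DIFFERENCE form: the coupling condition
   `‖t‖·(κ_CT(α) + κ_avg,CT(α) + kappa4CTd(α)) < 1` has ALL THREE constants vanishing with the background, so for `‖t‖ ≤ 1` it is a
   SMALL-FIELD condition on `(α, β)` at fixed small `κ` — the same logical shape as the END of record's threshold `η ≤ η⋆`.

HONEST FRAMING (T4-DAG p. 1).  Bookkeeping over landed modules ([folklore]); statements and constants OURS; MODEL level (no B0); the small-field
threshold is NOT computed explicitly (no `η⋆,CT(d, a, a′, κ)` is extracted — the condition is displayed as an inequality on explicit constants);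
explicit admissible `κ` NOT computed; `hNE3` OPEN; Δ3 NOT closed as a spine row; NE2 (U1a) NOT PROVED; spine PROVED 0/9 unchanged; NOT infinite
volume, NOT a mass gap, NOT the Clay problem, NOT summit progress.  HONEST DEPENDENCY: continuum YM on T⁴ ⇐ BetaPertH ∧ nine spine estimates
(0/9 proved); BetaPertH ⇐ (D1) ∧ (D4) ∧ CAP+tail; G-an2-4 gates asym, D1 and NE2/3/4.  ABSOLUTE RULE kept; no `sorry`.
-/

noncomputable section

open scoped BigOperators ComplexConjugate Matrix Matrix.Norms.L2Operator Kronecker ComplexOrder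

namespace Summit.QuantumFields.BalabanUV.T4Continuum.CTGaugeSlotDiff

open Literature.MathematicalPhysics.QuantumFieldTheory.Balaban1983to89.B5Prop11Plancherel (Cst Cst_nonneg Tor fine unitVec)
open Literature.MathematicalPhysics.QuantumFieldTheory.Balaban1983to89.B5G183RateUnitTower (lev lev_neZero)
open Literature.MathematicalPhysics.QuantumFieldTheory.Balaban1983to89.B5Blocks16 (blockOf)
open Literature.MathematicalPhysics.QuantumFieldTheory.Balaban1983to89.T4EtaRateMin (LocalRate)
open Summit.QuantumFields.BalabanUV.T4Continuum
open Summit.QuantumFields.BalabanUV.T4Continuum.CoerciveInverseTower (Coercive)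
open Summit.QuantumFields.BalabanUV.T4Continuum.BalabanAveragedTowerUnit (idx one_le_lev')
open Summit.QuantumFields.BalabanUV.T4Continuum.BackgroundResolventTower
open Summit.QuantumFields.BalabanUV.T4Continuum.KingPairingPlantedLaw (calDalev CJ)
open Summit.QuantumFields.BalabanUV.T4Continuum.BlockMultiplication (siteMul)
open Summit.QuantumFields.BalabanUV.T4Continuum.GramPerturbationLaw (C2gram)
open Summit.QuantumFields.BalabanUV.T4Continuum.NE2FromNE3 (bgReadings)
open Summit.QuantumFields.BalabanUV.T4Continuum.NE2ColourPerturbedLayer (pertCovC pertLimC)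
open Summit.QuantumFields.BalabanUV.T4Continuum.RegularBackgroundTower (RegularTransporters regClass betaNE3)
open Summit.QuantumFields.BalabanUV.T4Continuum.GaugeTermDecomposition (covGrad sand)
open Summit.QuantumFields.BalabanUV.T4Continuum.GaugeTermSandwichBound (projP Zop Nop sand_projP_eq)
open Summit.QuantumFields.BalabanUV.T4Continuum.GaugeTermPerturbationLaw (oneR gaugeTerm)
open Summit.QuantumFields.BalabanUV.T4Continuum.GaugeTermScalarData (QuT Q1)
open Summit.QuantumFields.BalabanUV.T4Continuum.RegularSiteTransporters (siteT norm_siteT_sub_one_le)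
open Summit.QuantumFields.BalabanUV.T4Continuum.NestedContourTransport (theta0)
open Summit.QuantumFields.BalabanUV.T4Continuum.NE2BalabanRoot (balabanPert)
open Summit.QuantumFields.BalabanUV.T4Continuum.NE2BalabanGauge (gaugeSlot liftR)
open Summit.QuantumFields.BalabanUV.T4Continuum.NE2BalabanLayerSharp (kappaBs C2Bs)
open Summit.QuantumFields.BalabanUV.T4Continuum.NE2BalabanWiring (epsR CdeltaR)
open Summit.QuantumFields.BalabanUV.T4Continuum.NE2BalabanFinal (kappa4F C4F)
open Summit.QuantumFields.BalabanUV.T4Continuum.NE2BalabanThreshold (etaStar)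
open Summit.QuantumFields.BalabanUV.T4Continuum.DecayRateInterpolation (EntryDecay DecayRate TwoLevelDecayRate)
open Summit.QuantumFields.BalabanUV.T4Continuum.ScalarAveragedPropagator (gammaPs)
open Summit.QuantumFields.BalabanUV.T4Continuum.ScalarAveragedCompression (sigma0)
open Summit.QuantumFields.BalabanUV.T4Continuum.ScalarCovariantLaplacian (scalarOp connS Bs)
open Summit.QuantumFields.BalabanUV.T4Continuum.ScalarCovariantCoercive (gammaU siteW Jcov Jcov_nonneg)
open Summit.QuantumFields.BalabanUV.T4Continuum.CTWeightedCoercivity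
open Summit.QuantumFields.BalabanUV.T4Continuum.CTScalarGreen (Jfree)
open Summit.QuantumFields.BalabanUV.T4Continuum.CTGaugeTerm (deltaK triple_sub)
open Summit.QuantumFields.BalabanUV.T4Continuum.CTVectorPropagator (JA)
open Summit.QuantumFields.BalabanUV.T4Continuum.CTWeightedEnergy (K2 K2_nonneg)
open Summit.QuantumFields.BalabanUV.T4Continuum.CTAveragedTowerDecay (opNorm_conjMat_kron_inv_le_of_wCoercive)
open Summit.QuantumFields.BalabanUV.T4Continuum.CTConjugatedHbd (wCoercive_calDa_of_conjDefect conjMat_neg)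
open Summit.QuantumFields.BalabanUV.T4Continuum.CTKingTowerWeights (rho rhoSite distKC abs_rhoSite_fineStep_le abs_rhoSite_sub_le_one_of_blockOf_eq)
open Summit.QuantumFields.BalabanUV.T4Continuum.CTCovariantLaplacianDecay (kappaColCT)
open Summit.QuantumFields.BalabanUV.T4Continuum.CTAveragingSummandHbd (kappaAvgCT)
open Summit.QuantumFields.BalabanUV.T4Continuum.CTConjDefectDischarge (conjDefect_calDalev_rho max_JA_lt_gamD
  balaban_final_decayStations_of_regular_small)
open Summit.QuantumFields.BalabanUV.T4Continuum.CTCovariantScalarGreen (bondCW cR)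
open Summit.QuantumFields.BalabanUV.T4Continuum.CTGaugeSandwichHbd
open Summit.QuantumFields.BalabanUV.T4Continuum.CTGaugeUnitFactorHbd (deltaKU opNorm_conjMat_Nop_le)
open Summit.QuantumFields.BalabanUV.T4Continuum.CTGaugeSlotHbd (gaugeP_eq_family gaugeP_one_eq_family coercive_gramK_one)
open Summit.QuantumFields.BalabanUV.T4Continuum.CTGaugeUnitDatum (deltaKB coercive_gramK_family)
open Summit.QuantumFields.BalabanUV.T4Continuum.DirichletRegionTower (gamD gamD_pos)

variable {d : ℕ}

/-! ## §6 The difference of the two conjugated gauge sandwiches at one level -/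

section Level

variable (n : ℕ) [NeZero n] (M : Fin d → ℕ) [hM : ∀ μ, NeZero (M μ)]
variable {o : Type*} [Fintype o] [DecidableEq o]
variable {ρ₀ : Tor (fine n M) → ℝ} {κ a' : ℝ}
variable {R : Fin d → (Tor (fine n M) → Matrix o o ℂ)} {T : Tor (fine n M) → Matrix o o ℂ} {α τ σU σ1 : ℝ}

/-- the bound of the conjugated sandwich difference: `B4diff = dZc·ν_U·z_U + z_1·(ν_U·dKc·ν_1)·z_U + z_1·ν_1·dZc`. [folklore] -/
def B4diff (co d : ℕ) (a' α τ σU σ1 κ : ℝ) : ℝ :=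
  dZc co d a' α τ κ * (σU - deltaKU co d a' α τ κ)⁻¹
      * (Real.exp |κ| * (1 + τ) * K2 (gammaU d a' α τ - Jcov co d a' α τ κ) (Jcov co d a' α τ κ) (cR d α κ))
    + (Real.exp |κ| * (1 + 0) * K2 (gammaU d a' 0 0 - Jcov co d a' 0 0 κ) (Jcov co d a' 0 0 κ) (cR d 0 κ))
      * ((σU - deltaKU co d a' α τ κ)⁻¹ * dKc co d a' α τ κ * (σ1 - deltaKU co d a' 0 0 κ)⁻¹)
      * (Real.exp |κ| * (1 + τ) * K2 (gammaU d a' α τ - Jcov co d a' α τ κ) (Jcov co d a' α τ κ) (cR d α κ))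
    + (Real.exp |κ| * (1 + 0) * K2 (gammaU d a' 0 0 - Jcov co d a' 0 0 κ) (Jcov co d a' 0 0 κ) (cR d 0 κ))
      * (σ1 - deltaKU co d a' 0 0 κ)⁻¹ * dZc co d a' α τ κ

/-- **THE CONJUGATED GAUGE SANDWICHES' DIFFERENCE VANISHES WITH THE BACKGROUND**: `‖c(D_R·P_U·D_Rᴴ) − c(D_1·P_1·D_1ᴴ)‖ ≤ B4diff`. [folklore] -/
theorem opNorm_conjMat_gaugeDiff_le (ha' : 0 < a') (hα : 0 ≤ α) (hτ : 0 ≤ τ)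
    (hR : ∀ μ x, ‖connS (fine n M) ((n : ℕ) : ℂ) R μ x‖ ≤ α) (hT : ∀ x, ‖T x - 1‖ ≤ τ)
    (hlip : ∀ x ν, |ρ₀ (x + unitVec (fine n M) ν) - ρ₀ x| ≤ 1 / n) (hosc : ∀ x x', blockOf n M x = blockOf n M x' → |ρ₀ x - ρ₀ x'| ≤ 1)
    (hγU : 0 < gammaU d a' α τ - Jcov (Fintype.card o) d a' α τ κ) (hγ1 : 0 < gammaU d a' 0 0 - Jcov (Fintype.card o) d a' 0 0 κ)
    (hKU : Coercive σU ((Bs o n M * siteMul T) * (scalarOp n M a' R T)⁻¹ * (scalarOp n M a' R T)⁻¹ * (Bs o n M * siteMul T)ᴴ))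
    (hK1 : Coercive σ1 ((Bs o n M * siteMul (fun _ : Tor (fine n M) => (1 : Matrix o o ℂ)))
      * (scalarOp n M a' (fun _ _ => (1 : Matrix o o ℂ)) (fun _ => 1))⁻¹ * (scalarOp n M a' (fun _ _ => (1 : Matrix o o ℂ)) (fun _ => 1))⁻¹
      * (Bs o n M * siteMul (fun _ : Tor (fine n M) => (1 : Matrix o o ℂ)))ᴴ))
    (hδU : deltaKU (Fintype.card o) d a' α τ κ < σU) (hδ1 : deltaKU (Fintype.card o) d a' 0 0 κ < σ1) :
    ‖conjMat κ (bondCW n M (o := o) ρ₀) (bondCW n M (o := o) ρ₀)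
        (sand (fine n M) ((n : ℕ) : ℂ) R (projP (fine n M) (scalarOp n M a' R T)⁻¹ (Bs o n M * siteMul T)))
      - conjMat κ (bondCW n M (o := o) ρ₀) (bondCW n M (o := o) ρ₀)
        (sand (fine n M) ((n : ℕ) : ℂ) (fun (_ : Fin d) (_ : Tor (fine n M)) => (1 : Matrix o o ℂ))
          (projP (fine n M) (scalarOp n M a' (fun _ _ => (1 : Matrix o o ℂ)) (fun _ => 1))⁻¹
            (Bs o n M * siteMul (fun _ : Tor (fine n M) => (1 : Matrix o o ℂ)))))‖
      ≤ B4diff (Fintype.card o) d a' α τ σU σ1 κ := by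
  have h0R : ∀ μ x, ‖connS (fine n M) ((n : ℕ) : ℂ) (fun (_ : Fin d) (_ : Tor (fine n M)) => (1 : Matrix o o ℂ)) μ x‖ ≤ 0 :=
    fun μ x => by simp [connS]
  have h0T : ∀ x : Tor (fine n M), ‖(fun _ : Tor (fine n M) => (1 : Matrix o o ℂ)) x - 1‖ ≤ 0 := fun x => by simp
  have hγU0 : 0 < gammaU d a' α τ := lt_of_lt_of_le hγU (sub_le_self _ (Jcov_nonneg _ _ ha'.le hα κ))
  have hγ10 : 0 < gammaU d a' 0 0 := lt_of_lt_of_le hγ1 (sub_le_self _ (Jcov_nonneg _ _ ha'.le le_rfl κ))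
  set ρB := bondCW n M (o := o) ρ₀
  set σ := coarseCW n M (o := o) ρ₀
  -- rewrite both sandwiches as conjugated `Zᴴ N Z`
  have eS : ∀ (Rf : Fin d → (Tor (fine n M) → Matrix o o ℂ)) (Tf : Tor (fine n M) → Matrix o o ℂ),
      conjMat κ ρB ρB (sand (fine n M) ((n : ℕ) : ℂ) Rf (projP (fine n M) (scalarOp n M a' Rf Tf)⁻¹ (Bs o n M * siteMul Tf)))
      = conjMat κ ρB σ (Zop (fine n M) ((n : ℕ) : ℂ) Rf (scalarOp n M a' Rf Tf)⁻¹ (Bs o n M * siteMul Tf))ᴴ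
        * conjMat κ σ σ (Nop (fine n M) (scalarOp n M a' Rf Tf)⁻¹ (Bs o n M * siteMul Tf))
        * conjMat κ σ ρB (Zop (fine n M) ((n : ℕ) : ℂ) Rf (scalarOp n M a' Rf Tf)⁻¹ (Bs o n M * siteMul Tf)) := by
    intro Rf Tf
    rw [sand_projP_eq (fine n M) ((n : ℕ) : ℂ) Rf (scalarOp_inv_isHermitian n M a' Rf Tf) (Bs o n M * siteMul Tf),
      conjMat_mul κ ρB σ ρB, conjMat_mul κ ρB σ σ]
  rw [eS, eS, triple_sub]
  -- the six bounds
  have hZU := opNorm_conjMat_Z_le n M (ρ₀ := ρ₀) (κ := κ) ha' hα hτ hR hT hlip hosc hγU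
  have hZ1H := opNorm_conjMat_ZH_le n M (ρ₀ := ρ₀) (κ := κ) ha' le_rfl le_rfl h0R h0T hlip hosc hγ1
  have hNU := opNorm_conjMat_Nop_le n M (ρ₀ := ρ₀) (κ := κ) ha' hα hτ hR hT hlip hosc hγU0 hγU hKU hδU
  have hN1 := opNorm_conjMat_Nop_le n M (ρ₀ := ρ₀) (κ := κ) ha' le_rfl le_rfl h0R h0T hlip hosc hγ10 hγ1 hK1 hδ1
  have hdZ := opNorm_conjMat_Zdiff_le n M (ρ₀ := ρ₀) (κ := κ) ha' hα hτ hR hT hlip hosc hγU hγ1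
  have hdZH := opNorm_conjMat_ZHdiff_le n M (ρ₀ := ρ₀) (κ := κ) ha' hα hτ hR hT hlip hosc hγU hγ1
  have hdN := opNorm_conjMat_Ndiff_le n M (ρ₀ := ρ₀) (κ := κ) ha' hα hτ hR hT hlip hosc hγU hγ1 hKU hK1 hδU hδ1
  have hνU : 0 ≤ (σU - deltaKU (Fintype.card o) d a' α τ κ)⁻¹ := inv_nonneg.mpr (sub_pos.mpr hδU).le
  have hν1 : 0 ≤ (σ1 - deltaKU (Fintype.card o) d a' 0 0 κ)⁻¹ := inv_nonneg.mpr (sub_pos.mpr hδ1).le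
  have hdZnn : 0 ≤ dZc (Fintype.card o) d a' α τ κ := (norm_nonneg _).trans hdZ
  have hz1nn : 0 ≤ Real.exp |κ| * (1 + 0) * K2 (gammaU d a' 0 0 - Jcov (Fintype.card o) d a' 0 0 κ) (Jcov (Fintype.card o) d a' 0 0 κ)
      (cR d 0 κ) := by have := K2_nonneg (gammaU d a' 0 0 - Jcov (Fintype.card o) d a' 0 0 κ) (Jcov (Fintype.card o) d a' 0 0 κ) (cR d 0 κ); positivity
  refine (norm_add_le _ _).trans ((add_le_add ((norm_add_le _ _).trans (add_le_add ?_ ?_)) ?_).trans (le_of_eq (by rw [B4diff])))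
  · exact (Matrix.l2_opNorm_mul _ _).trans (mul_le_mul ((Matrix.l2_opNorm_mul _ _).trans (mul_le_mul hdZH hNU (norm_nonneg _) hdZnn))
      hZU (norm_nonneg _) (mul_nonneg hdZnn hνU))
  · exact (Matrix.l2_opNorm_mul _ _).trans (mul_le_mul ((Matrix.l2_opNorm_mul _ _).trans (mul_le_mul hZ1H hdN (norm_nonneg _) hz1nn))
      hZU (norm_nonneg _) (mul_nonneg hz1nn (mul_nonneg (mul_nonneg hνU ((norm_nonneg _).trans
        (opNorm_conjMat_gramKdiff_le n M (ρ₀ := ρ₀) (κ := κ) ha' hα hτ hR hT hlip hosc hγU hγ1))) hν1)))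
  · exact (Matrix.l2_opNorm_mul _ _).trans (mul_le_mul ((Matrix.l2_opNorm_mul _ _).trans (mul_le_mul hZ1H hN1 (norm_nonneg _) hz1nn))
      hdZ (norm_nonneg _) (mul_nonneg hz1nn hν1))

end Level

/-! ## §7 The gauge slot in difference form on the (3.35)-class, and ROOT B's decay stations at small field -/

section Tower

variable (L : ℕ) [NeZero L] (M : Fin d → ℕ) [hM : ∀ μ, NeZero (M μ)] (a : ℝ) (ha : 0 < a)
variable {o : Type*} [Fintype o] [DecidableEq o]

/-- the gauge slot's conjugated Neumann constant in DIFFERENCE form: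
`kappa4CTd = B4diff(α, e^{(d+1)α} − 1, σ₀² − deltaKB, σ₀²)·(γ_D − J)⁻¹` — VANISHES with the background. [folklore] -/
def kappa4CTd (co d : ℕ) (a a' α J κ : ℝ) : ℝ :=
  B4diff co d a' α (Real.exp ((d + 1 : ℕ) * α) - 1) (sigma0 d a' ^ 2 - deltaKB d a' α (Real.exp ((d + 1 : ℕ) * α) - 1)) (sigma0 d a' ^ 2) κ
    * (gamD d a - J)⁻¹

/-- **`hP₄` IN DIFFERENCE FORM**: on the (3.35)-class (`d ≥ 1`), with both unit data THEOREMS (E3's `coercive_gramK_one`, E4's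
`coercive_gramK_family`), for every level and base point `‖c(gaugeSlot k)·c((Δ_a^{(k)}⊗1)⁻¹)‖ ≤ kappa4CTd`. [folklore] -/
theorem hP4diff_gaugeSlot_of_regular (hd : 1 ≤ d) {Rg : (k : ℕ) → Fin d → (Tor (fine (lev L k) M) → Matrix o o ℂ)} {α β : ℝ}
    (hreg : RegularTransporters L M (liftR L M Rg) α β) {a' : ℝ} (ha' : 0 < a') {κ J : ℝ}
    (hJ : ∀ (k : ℕ) (y : idx L M 0), ConjDefect (calDalev L M a ha k) κ (rho L M k y) J) (hJγ : J < gamD d a)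
    (hγ : 0 < gammaU d a' α (Real.exp ((d + 1 : ℕ) * α) - 1) - Jcov (Fintype.card o) d a' α (Real.exp ((d + 1 : ℕ) * α) - 1) κ)
    (hγ1 : 0 < gammaU d a' 0 0 - Jcov (Fintype.card o) d a' 0 0 κ)
    (hδU : deltaKU (Fintype.card o) d a' α (Real.exp ((d + 1 : ℕ) * α) - 1) κ
      < sigma0 d a' ^ 2 - deltaKB d a' α (Real.exp ((d + 1 : ℕ) * α) - 1))
    (hδ1 : deltaKU (Fintype.card o) d a' 0 0 κ < sigma0 d a' ^ 2)
    (k : ℕ) (y : idx L M 0 × o) :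
    ‖conjMat κ (fun p : idx L M k × o => rho L M k y.1 p.1) (fun p : idx L M k × o => rho L M k y.1 p.1)
          (gaugeSlot L M Rg (QuT L M o (siteT L M Rg)) (Q1 L M o) a' k)
        * conjMat κ (fun p : idx L M k × o => rho L M k y.1 p.1) (fun p : idx L M k × o => rho L M k y.1 p.1)
          (calDalev L M a ha k ⊗ₖ (1 : Matrix o o ℂ))⁻¹‖
      ≤ kappa4CTd (Fintype.card o) d a a' α J κ := by
  haveI := lev_neZero L k
  have hα : 0 ≤ α := hreg.nonneg.1
  set τ : ℝ := Real.exp ((d + 1 : ℕ) * α) - 1 with hτdef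
  have hτ : 0 ≤ τ := sub_nonneg.mpr (Real.one_le_exp (by positivity))
  have hR : ∀ μ x, ‖connS (fine (lev L k) M) ((lev L k : ℕ) : ℂ) (Rg k) μ x‖ ≤ α := fun μ x => hreg.size k μ (x, μ)
  have hT : ∀ x, ‖siteT L M Rg k x - 1‖ ≤ τ := fun x => norm_siteT_sub_one_le hd hreg k x
  have hlip := fun x ν => abs_rhoSite_fineStep_le L M k y.1 x ν
  have hosc := fun x x' hx => abs_rhoSite_sub_le_one_of_blockOf_eq L M k y.1 x x' hx
  have hγU0 : 0 < gammaU d a' α τ := lt_of_lt_of_le hγ (sub_le_self _ (Jcov_nonneg _ _ ha'.le hα κ))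
  have hKU := coercive_gramK_family (lev L k) M (T := siteT L M Rg k) ha' hα hτ hR hT hγU0
  have hK1 := coercive_gramK_one M (o := o) ha' (lev L k)
  have hdiff := opNorm_conjMat_gaugeDiff_le (lev L k) M (ρ₀ := rhoSite L M k y.1) (κ := κ) ha' hα hτ hR hT hlip hosc hγ hγ1 hKU hK1
    hδU hδ1
  have hW := wCoercive_calDa_of_conjDefect (lev L k) (one_le_lev' L k) M a ha (hJ k y.1)
  have hγA : 0 < gamD d a - J := sub_pos.mpr hJγ
  have hG := opNorm_conjMat_kron_inv_le_of_wCoercive (o := o) hW hγA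
  have e : gaugeSlot L M Rg (QuT L M o (siteT L M Rg)) (Q1 L M o) a' k
      = -(sand (fine (lev L k) M) ((lev L k : ℕ) : ℂ) (Rg k)
            (projP (fine (lev L k) M) (scalarOp (lev L k) M a' (Rg k) (siteT L M Rg k))⁻¹ (Bs o (lev L k) M * siteMul (siteT L M Rg k)))
          - sand (fine (lev L k) M) ((lev L k : ℕ) : ℂ) (fun _ _ => (1 : Matrix o o ℂ))
            (projP (fine (lev L k) M) (scalarOp (lev L k) M a' (fun _ _ => (1 : Matrix o o ℂ)) (fun _ => (1 : Matrix o o ℂ)))⁻¹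
              (Bs o (lev L k) M * siteMul (fun _ : Tor (fine (lev L k) M) => (1 : Matrix o o ℂ))))) := by
    rw [gaugeSlot, gaugeTerm, gaugeP_eq_family, gaugeP_one_eq_family]
  rw [e, conjMat_neg, neg_mul, norm_neg, conjMat_sub]
  have hB0 := (norm_nonneg _).trans hdiff
  calc _ ≤ ‖_‖ * ‖_‖ := Matrix.l2_opNorm_mul _ _
    _ ≤ B4diff (Fintype.card o) d a' α τ (sigma0 d a' ^ 2 - deltaKB d a' α τ) (sigma0 d a' ^ 2) κ * (gamD d a - J)⁻¹ :=
        mul_le_mul hdiff hG (norm_nonneg _) hB0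
    _ = kappa4CTd (Fintype.card o) d a a' α J κ := by rw [kappa4CTd, hτdef]

/-- **ROOT B IN THE DECAY CURRENCY AT SMALL FIELD** (`L ≥ 2`, `d ≥ 1`): the owner's `NE2BalabanDecayRate.balaban_final_decayStations_of_regular`
— binders `hreg`, `hNE3` (BY NAME, OPEN), `a′ > 0`, `α, β ≤ η ≤ η⋆`, `‖t‖ ≤ 1` — with `hdec` supplied by the whole chain and the gauge slot in
DIFFERENCE form: what remains is an auxiliary mass `a″ > 0`, NUMERIC smallness of the rate `κ` (`Jfree`, `deltaK`, `JA`, `Jcov`, `deltaKU`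
conditions) and the coupling condition `‖t‖·(κ_CT + κ_avg,CT + kappa4CTd) < 1` in which ALL THREE constants vanish with the background
`(α, β) → 0` — a SMALL-FIELD condition reachable at the physical coupling `t = 1`.  Model level; CONDITIONAL on NE3 + the (3.35)-class + the
threshold; the small-field threshold is not extracted as a number; NE2 (U1a) is NOT proved by this. [cite: King1986, Lemma 4.5 (4.38) p.674
(shape); Balaban1985BackgroundPropagators, Thm 3.4 p.400 (shape)] [folklore] -/
theorem balaban_final_decayStations_of_regular_smallField (hL : 2 ≤ L) (hd : 1 ≤ d)
    {Rg : (k : ℕ) → Fin d → (Tor (fine (lev L k) M) → Matrix o o ℂ)}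
    {α β : ℝ} (hreg : RegularTransporters L M (liftR L M Rg) α β) {C : ℝ} (hC : 0 ≤ C)
    (hNE3 : LocalRate (bgReadings L M (regClass L M (liftR L M Rg))) C ((L : ℝ)⁻¹)) {a' : ℝ} (ha' : 0 < a')
    {η : ℝ} (hαη : α ≤ η) (hβη : β ≤ η) (hη : η ≤ etaStar o d a a') {t : ℂ} (ht : ‖t‖ ≤ 1)
    {a'' κ : ℝ} (ha'' : 0 < a'') (hκ : 0 ≤ κ) (hγ' : Jfree d a'' κ 1 < gammaPs d a'') (hδ' : deltaK d a'' κ 1 < sigma0 d a'' ^ 2)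
    (hJA : JA d a a'' κ 1 < gamD d a)
    (hγ : 0 < gammaU d a' α (Real.exp ((d + 1 : ℕ) * α) - 1) - Jcov (Fintype.card o) d a' α (Real.exp ((d + 1 : ℕ) * α) - 1) κ)
    (hγ1 : 0 < gammaU d a' 0 0 - Jcov (Fintype.card o) d a' 0 0 κ)
    (hδU : deltaKU (Fintype.card o) d a' α (Real.exp ((d + 1 : ℕ) * α) - 1) κ
      < sigma0 d a' ^ 2 - deltaKB d a' α (Real.exp ((d + 1 : ℕ) * α) - 1))
    (hδ1 : deltaKU (Fintype.card o) d a' 0 0 κ < sigma0 d a' ^ 2)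
    (htK : ‖t‖ * (kappaColCT o d a α β (d * (α ^ 2 + 2 * β)) (max (JA d a a'' κ 1) 0) κ
      + kappaAvgCT (Fintype.card o) d a α (max (JA d a a'' κ 1) 0) κ
      + kappa4CTd (Fintype.card o) d a a' α (max (JA d a a'' κ 1) 0) κ) < 1) :
    EntryDecay (distKC L M o)
        (pertLimC L M a ha (balabanPert L M a (liftR L M Rg) (gaugeSlot L M Rg (QuT L M o (siteT L M Rg)) (Q1 L M o) a')) t)
        ((gamD d a - max (JA d a a'' κ 1) 0)⁻¹ * (1 - ‖t‖ * (kappaColCT o d a α β (d * (α ^ 2 + 2 * β)) (max (JA d a a'' κ 1) 0) κ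
      + kappaAvgCT (Fintype.card o) d a α (max (JA d a a'' κ 1) 0) κ
      + kappa4CTd (Fintype.card o) d a a' α (max (JA d a a'' κ 1) 0) κ))⁻¹ * Real.exp (κ * 2)) κ ∧
      DecayRate (distKC L M o)
        (pertCovC L M a ha (balabanPert L M a (liftR L M Rg) (gaugeSlot L M Rg (QuT L M o (siteT L M Rg)) (Q1 L M o) a')) t)
        (pertLimC L M a ha (balabanPert L M a (liftR L M Rg) (gaugeSlot L M Rg (QuT L M o (siteT L M Rg)) (Q1 L M o) a')) t)
        (Real.sqrt (2 * ((gamD d a - max (JA d a a'' κ 1) 0)⁻¹ * (1 - ‖t‖ * (kappaColCT o d a α β (d * (α ^ 2 + 2 * β)) (max (JA d a a'' κ 1) 0) κ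
      + kappaAvgCT (Fintype.card o) d a α (max (JA d a a'' κ 1) 0) κ
      + kappa4CTd (Fintype.card o) d a a' α (max (JA d a a'' κ 1) 0) κ))⁻¹ * Real.exp (κ * 2)) *
          (Cpert (kappaBs o d a α β (a * (epsR o d α * (2 + epsR o d α) * Cst d a)) (kappa4F d a a' α β)) (2 * d * Cst d a) (CJ d a)
              (C2Bs o d L a α β C
                (a * C2gram (Cst d a) 1 (epsR o d α) (2 * d * Cst d a) (CJ d a) (Cst d a) (CdeltaR o d a α (theta0 d α (betaNE3 o C))))
                (C4F o d L a a' α β C)) 0 t / (1 - (L : ℝ)⁻¹))))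
        (κ / 2) (Real.sqrt ((L : ℝ)⁻¹)) ∧
      TwoLevelDecayRate (distKC L M o)
        (pertCovC L M a ha (balabanPert L M a (liftR L M Rg) (gaugeSlot L M Rg (QuT L M o (siteT L M Rg)) (Q1 L M o) a')) t)
        (Real.sqrt (2 * ((gamD d a - max (JA d a a'' κ 1) 0)⁻¹ * (1 - ‖t‖ * (kappaColCT o d a α β (d * (α ^ 2 + 2 * β)) (max (JA d a a'' κ 1) 0) κ
      + kappaAvgCT (Fintype.card o) d a α (max (JA d a a'' κ 1) 0) κ
      + kappa4CTd (Fintype.card o) d a a' α (max (JA d a a'' κ 1) 0) κ))⁻¹ * Real.exp (κ * 2)) * (2 *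
          Cpert (kappaBs o d a α β (a * (epsR o d α * (2 + epsR o d α) * Cst d a)) (kappa4F d a a' α β)) (2 * d * Cst d a) (CJ d a)
              (C2Bs o d L a α β C
                (a * C2gram (Cst d a) 1 (epsR o d α) (2 * d * Cst d a) (CJ d a) (Cst d a) (CdeltaR o d a α (theta0 d α (betaNE3 o C))))
                (C4F o d L a a' α β C)) 0 t / (1 - (L : ℝ)⁻¹))))
        (κ / 2) (Real.sqrt ((L : ℝ)⁻¹)) :=
  balaban_final_decayStations_of_regular_small L M a ha hL hd hreg hC hNE3 ha' hαη hβη hη ht ha'' hκ hγ' hδ' hJA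
    (hP4diff_gaugeSlot_of_regular L M a ha hd hreg ha' (conjDefect_calDalev_rho L M a ha ha'' hγ' hδ') (max_JA_lt_gamD a hJA)
      hγ hγ1 hδU hδ1) htK

end Tower

end Summit.QuantumFields.BalabanUV.T4Continuum.CTGaugeSlotDiff

end
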